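import Mathlib
import Summits.NavierStokesRegularity.NavierStokesRegularity.Theorems.SubOnsagerCeilingKPRelabelCorners
import Summits.NavierStokesRegularity.NavierStokesRegularity.Theorems.SubOnsagerCeilingKPSideBranchClassTenCeiling
import Summits.NavierStokesRegularity.NavierStokesRegularity.Theorems.SubOnsagerCeilingKPCruxCurrency
import HarnessLib

/-!
# STUB 1 of crux 27057 on the SIDE-BRANCH CLASSES (RUNGS 5 and 9), in the stub's own currency, at any placement
# (helper file for the crux `SubOnsagerCeiling.ForwardTailCeilingKP`, stmt-NavierStokesRegularity-27057, `--supports`;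
# hand leafhand-ns-subonsagerceiling-4 gen 22 — companion of `SubOnsagerCeilingKPStubOneCorners`)

The two side-branch corners of the LEAD skeleton `Cruxes/ForwardTailCeilingKP/Lines/kp_shell_barrier.lean` — RUNG 5
(`sideClass_fwdCeilingKP`: chain `c₀` on a component, in-shell pump `P` into a second component, exit feed `f` from it into a DEAD-END
pocket, weights `13P² < f²κ⁴`, `5Pκb^{5/2} ≤ c₀b^{2θ}`, `Pb^{5/2} ≤ 2c₀b^{2θ}`, every `b ∈ [1.9, 2]`) and RUNG 9 (`sideClass_fwdCeilingKP_ten`: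
the HALVED-PUMP sub-class `10Pκb^{5/2} ≤ c₀b^{2θ}`, `Pb^{5/2} ≤ c₀b^{2θ}`, every `b ∈ [1.78, 2]`) — are landed in the crux's per-table
currency `FwdCeilingKPAt` (forward-source set `S = {chain, side}`).  This file restates them (no new analysis)

* at ANY placement `σ` of the three active components (relabeling covariance `kpRelabel_fwdCeilingKPAt`; RUNG 5 at any placement is
  `kpRelabel_sideClass_fwdCeilingKP`, RUNG 9 at any placement is `kpRelabel_sideClassTen_fwdCeilingKP` below), and
* in the currency of the registered stub `stub_primaryGradedLargeRatio` — the body of `PrimaryGradedAt R ε₀ β` verbatim — through the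
  currency lemma `kpPrimaryGraded_of_fwdCeilingKPAt` (grading `lev = 0` on `S`, `1` off `S`; `θ' = min θ 1`):
  `stubOne_on_sideBranchClass` (`b ∈ [1.9, 2]`), `stubOne_on_sideBranchClassTen` (`b ∈ [1.78, 2]`).

HONEST FRAMING: bookkeeping about Tao-type MODEL lattice ODEs (route SubOnsagerCeiling, rung TL-M2Break); no stub, crux or summit is proved
and nothing here bears on Navier–Stokes regularity. [cite: Tao2016AveragedNS, §4 (4.2)–(4.3), (4.13)] [cite: BarbatoMorandinRomito2011, §3.2]
-/

noncomputable section

-- the sub-problem namespace `NavierStokesRegularity.NavierStokesRegularity` is the tree's layout (D-0017)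
set_option linter.dupNamespace false

namespace Summit.NavierStokesRegularity.NavierStokesRegularity.Theorems

open Literature.Analysis.FluidPDE.TaoCascade
open Summit.NavierStokesRegularity.NavierStokesRegularity.Theorems.SubOnsagerCeiling

variable {β : Fin 4 → Fin 4 → Fin 4 → ℤ × ℤ × ℤ → ℝ} (σ : Equiv.Perm (Fin 4))

/-- **RUNG 9 (halved-pump side-branch class, `b ∈ [1.78, 2]`) at any placement**: chain `c₀` on component `σ⁻¹ 0`, in-shell pump `P`
from it into `σ⁻¹ 1`, exit feed `f` from `σ⁻¹ 1` into the dead-end pocket `σ⁻¹ 2` (hypotheses of `sideClass_fwdCeilingKP_ten` read through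
`σ`): the per-table body `FwdCeilingKPAt R ε₀ β` of the crux. Same bookkeeping as `kpRelabel_sideClass_fwdCeilingKP`.
[cite: Tao2016AveragedNS, §4 (4.13)] [cite: BarbatoMorandinRomito2011, §3.2] -/
theorem kpRelabel_sideClassTen_fwdCeilingKP (R : ℝ) {ε₀ c₀ P f κ : ℝ} (hε : 39 / 50 ≤ ε₀) (hε1 : ε₀ ≤ 1)
    (hw : ∀ a c : Fin 4, β a a c (0, 0, 1) =
      (if σ a = 0 ∧ σ c = 0 then c₀ else 0) + (if σ a = 1 ∧ σ c = 2 then f else 0))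
    (hP : ∀ a c : Fin 4, a ≠ c → β a a c (0, 0, 0) = if σ a = 0 ∧ σ c = 1 then P else 0)
    (hCz : ∀ a b c : Fin 4, a ≠ b → a ≠ c → b ≠ c → β a b c (0, 0, 0) = 0)
    (hc₀ : 0 < c₀) (hP0 : 0 ≤ P) (hf : 0 < f) (hκ : 0 < κ)
    (hpair : 13 * P ^ 2 < f ^ 2 * κ ^ 4)
    (hdrain : 10 * P * κ * (1 + ε₀) ^ ((5 : ℝ) / 2) ≤ c₀ * ((1 + ε₀) ^ ((101 : ℝ) / 200)) ^ 2)
    (hP1 : P * (1 + ε₀) ^ ((5 : ℝ) / 2) ≤ c₀ * ((1 + ε₀) ^ ((101 : ℝ) / 200)) ^ 2) :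
    Literature.Analysis.FluidPDE.TaoCascade.InTableClass R β → (∀ (Y : Fin 4 → ℤ → ℝ → ℝ) (τ : ℝ), (∀ (j : Fin 4) (k : ℤ), 1 ≤ k → 0 ≤ Y j k τ) → ∀ δ : ℝ, 0 < δ → ∀ (i : Fin 4) (n : ℤ), 1 ≤ n → Y i n τ = 0 → 0 ≤ Literature.Analysis.FluidPDE.TaoCascade.quadTerm δ β Y i n τ) → (∀ a b i : Fin 4, a ≠ b → β a b i (0, 0, 1) = 0) → ∃ S : Finset (Fin 4), (∀ i, i ∉ S → ∀ j l : Fin 4, β i j l (0, 0, 1) = 0) ∧ ∃ θ : ℝ, 1 / 2 < θ ∧ ∃ C : ℝ, 0 ≤ C ∧ ∀ ν : ℝ, 0 < ν → ∀ (X₀ : Fin 4 → ℝ) (s : ℝ), 0 < s → ∀ X : Fin 4 → ℤ → ℝ → ℝ, (∀ (i : Fin 4) (k : ℤ), X i k 0 = if k = 0 then X₀ i else 0) → (∀ (i : Fin 4) (k : ℤ), k < 0 → ∀ t : ℝ, X i k t = 0) → (∃ M : ℝ, ∀ (t : ℝ) (i : Fin 4) (k : ℤ), (1 + (1 + ε₀)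 ^ ((10 : ℝ) * k)) * |X i k t| ≤ M) → (∀ (i : Fin 4) (k : ℤ), Continuous (X i k)) → (∀ (i : Fin 4) (k : ℤ), ∀ t ∈ Set.Icc (0 : ℝ) s, HasDerivWithinAt (X i k) (Literature.Analysis.FluidPDE.TaoCascade.quadTerm ε₀ β X i k t - ν * (1 + ε₀) ^ ((2 : ℝ) * k) * X i k t) (Set.Icc (0 : ℝ) s) t) → (∀ t ∈ Set.Icc (0 : ℝ) s, ∀ (i : Fin 4) (k : ℤ), 1 ≤ k → 0 ≤ X i k t) → ∀ n N : ℕ, n ≤ N → ∀ t ∈ Set.Icc (0 : ℝ) s, ∑ k ∈ Finset.Icc n N, ∑ i ∈ S, (1 / 2 : ℝ) * X i (k : ℤ) t ^ 2 ≤ C * (∑ i : Fin 4, (1 / 2 : ℝ) * X₀ i ^ 2) * (1 + ε₀) ^ (-(2 * θ * (n : ℝ))) := by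
  -- the table read through `σ⁻¹` is in the one-placement halved-pump side-branch class
  set α : Fin 4 → Fin 4 → Fin 4 → ℤ × ℤ × ℤ → ℝ := fun i₁ i₂ i₃ μ => β (σ.symm i₁) (σ.symm i₂) (σ.symm i₃) μ
    with hα_def
  have hβ : ∀ i₁ i₂ i₃ μ, β i₁ i₂ i₃ μ = α (σ i₁) (σ i₂) (σ i₃) μ := by
    intro i₁ i₂ i₃ μ
    simp only [hα_def, Equiv.symm_apply_apply]
  have hne : ∀ {a b : Fin 4}, a ≠ b → σ.symm a ≠ σ.symm b := fun h h' => h (σ.symm.injective h')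
  have hw' : ∀ a c : Fin 4, α a a c (0, 0, 1) =
      (if a = 0 ∧ c = 0 then c₀ else 0) + (if a = 1 ∧ c = 2 then f else 0) := by
    intro a c
    simp only [hα_def, hw, Equiv.apply_symm_apply]
  have hP' : ∀ a c : Fin 4, a ≠ c → α a a c (0, 0, 0) = if a = 0 ∧ c = 1 then P else 0 := by
    intro a c hac
    simp only [hα_def, hP _ _ (hne hac), Equiv.apply_symm_apply]
  have hCz' : ∀ a b c : Fin 4, a ≠ b → a ≠ c → b ≠ c → α a b c (0, 0, 0) = 0 := by
    intro a b c hab hac hbc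
    simp only [hα_def]
    exact hCz _ _ _ (hne hab) (hne hac) (hne hbc)
  exact kpRelabel_fwdCeilingKPAt σ hβ
    (sideClass_fwdCeilingKP_ten R hε hε1 hw' hP' hCz' hc₀ hP0 hf hκ hpair hdrain hP1)

/-- **STUB 1 on the side-branch class (RUNG 5, `b ∈ [1.9, 2]`), own currency, any placement**: for a table `β` of the side-branch class
placed by `σ` (hypotheses of `kpRelabel_sideClass_fwdCeilingKP`) and `ε₀ ∈ [9/10, 1]`, the body of `PrimaryGradedAt R ε₀ β` verbatim
(grading `lev = 0` on the forward sources `{σ⁻¹ 0, σ⁻¹ 1}`, `1` on the pocket and the idle component). MODEL lattice statement.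
[cite: Tao2016AveragedNS, §4 (4.13)] [cite: BarbatoMorandinRomito2011, §3.2] -/
theorem stubOne_on_sideBranchClass (R : ℝ) {ε₀ c₀ P f κ : ℝ} (hε : 9 / 10 ≤ ε₀) (hε1 : ε₀ ≤ 1)
    (hw : ∀ a c : Fin 4, β a a c (0, 0, 1) =
      (if σ a = 0 ∧ σ c = 0 then c₀ else 0) + (if σ a = 1 ∧ σ c = 2 then f else 0))
    (hP : ∀ a c : Fin 4, a ≠ c → β a a c (0, 0, 0) = if σ a = 0 ∧ σ c = 1 then P else 0)
    (hCz : ∀ a b c : Fin 4, a ≠ b → a ≠ c → b ≠ c → β a b c (0, 0, 0) = 0)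
    (hc₀ : 0 < c₀) (hP0 : 0 ≤ P) (hf : 0 < f) (hκ : 0 < κ)
    (hpair : 13 * P ^ 2 < f ^ 2 * κ ^ 4)
    (hdrain : 5 * P * κ * (1 + ε₀) ^ ((5 : ℝ) / 2) ≤ c₀ * ((1 + ε₀) ^ ((101 : ℝ) / 200)) ^ 2)
    (hP1 : P * (1 + ε₀) ^ ((5 : ℝ) / 2) ≤ 2 * c₀ * ((1 + ε₀) ^ ((101 : ℝ) / 200)) ^ 2) :
    Literature.Analysis.FluidPDE.TaoCascade.InTableClass R β →
      (∀ (Y : Fin 4 → ℤ → ℝ → ℝ) (τ : ℝ), (∀ (j : Fin 4) (k : ℤ), 1 ≤ k → 0 ≤ Y j k τ) → ∀ δ : ℝ, 0 < δ →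
        ∀ (i : Fin 4) (n : ℤ), 1 ≤ n → Y i n τ = 0 → 0 ≤ Literature.Analysis.FluidPDE.TaoCascade.quadTerm δ β Y i n τ) →
      (∀ a b i : Fin 4, a ≠ b → β a b i (0, 0, 1) = 0) →
      ∃ (lev : Fin 4 → ℕ) (L : ℕ), (∀ a, lev a ≤ L) ∧
        (∀ a, lev a ≠ 0 → (∃ e, β a a e (0, 0, 1) ≠ 0) →
          (∀ j, β j j a (0, 0, 1) ≠ 0 → lev j < lev a ∧ (lev j = 0 ∨ ∃ e', β j j e' (0, 0, 1) ≠ 0)) ∧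
          (∀ i₁ i₂, i₁ ≠ a → i₂ ≠ a → β i₁ i₂ a (0, 0, 0) ≠ 0 →
            (lev i₁ < lev a ∧ (lev i₁ = 0 ∨ ∃ e', β i₁ i₁ e' (0, 0, 1) ≠ 0)) ∧
            (lev i₂ < lev a ∧ (lev i₂ = 0 ∨ ∃ e', β i₂ i₂ e' (0, 0, 1) ≠ 0))) ∧
          (∃ e, β a a e (0, 0, 1) ≠ 0 ∧
            (∀ j, β e e j (0, 0, 1) ≠ 0 → lev j < lev a ∧ (lev j = 0 ∨ ∃ e', β j j e' (0, 0, 1) ≠ 0)) ∧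
            (∀ j, j ≠ e → β e e j (0, 0, 0) ≠ 0 →
              lev j < lev a ∧ (lev j = 0 ∨ ∃ e', β j j e' (0, 0, 1) ≠ 0)))) ∧
        ∃ θ : ℝ, 1 / 2 < θ ∧ θ ≤ 1 ∧ ∃ D : ℝ, 0 ≤ D ∧
          ∀ ν : ℝ, 0 < ν → ∀ (X₀ : Fin 4 → ℝ) (s : ℝ), 0 < s → ∀ X : Fin 4 → ℤ → ℝ → ℝ,
          (∀ (i : Fin 4) (k : ℤ), X i k 0 = if k = 0 then X₀ i else 0) →
          (∀ (i : Fin 4) (k : ℤ), k < 0 → ∀ t : ℝ, X i k t = 0) →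
          (∃ M : ℝ, ∀ (t : ℝ) (i : Fin 4) (k : ℤ), (1 + (1 + ε₀) ^ ((10 : ℝ) * k)) * |X i k t| ≤ M) →
          (∀ (i : Fin 4) (k : ℤ), Continuous (X i k)) →
          (∀ (i : Fin 4) (k : ℤ), ∀ t ∈ Set.Icc (0 : ℝ) s, HasDerivWithinAt (X i k)
            (Literature.Analysis.FluidPDE.TaoCascade.quadTerm ε₀ β X i k t - ν * (1 + ε₀) ^ ((2 : ℝ) * k) * X i k t)
            (Set.Icc (0 : ℝ) s) t) →
          (∀ t ∈ Set.Icc (0 : ℝ) s, ∀ (i : Fin 4) (k : ℤ), 1 ≤ k → 0 ≤ X i k t) →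
          ∀ t ∈ Set.Icc (0 : ℝ) s, ∀ i, lev i = 0 → ∀ k : ℕ,
            (1 + ε₀) ^ (2 * θ * (k : ℝ)) * ((1 / 2 : ℝ) * X i (k : ℤ) t ^ 2) ≤
              D * (∑ j : Fin 4, (1 / 2 : ℝ) * X₀ j ^ 2) :=
  kpPrimaryGraded_of_fwdCeilingKPAt (by linarith)
    (kpRelabel_sideClass_fwdCeilingKP σ R hε hε1 hw hP hCz hc₀ hP0 hf hκ hpair hdrain hP1)

/-- **STUB 1 on the halved-pump side-branch class (RUNG 9, `b ∈ [1.78, 2]`), own currency, any placement**: for a table `β` of the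
halved-pump side-branch class placed by `σ` and `ε₀ ∈ [39/50, 1]`, the body of `PrimaryGradedAt R ε₀ β` verbatim. MODEL lattice
statement. [cite: Tao2016AveragedNS, §4 (4.13)] [cite: BarbatoMorandinRomito2011, §3.2] -/
theorem stubOne_on_sideBranchClassTen (R : ℝ) {ε₀ c₀ P f κ : ℝ} (hε : 39 / 50 ≤ ε₀) (hε1 : ε₀ ≤ 1)
    (hw : ∀ a c : Fin 4, β a a c (0, 0, 1) =
      (if σ a = 0 ∧ σ c = 0 then c₀ else 0) + (if σ a = 1 ∧ σ c = 2 then f else 0))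
    (hP : ∀ a c : Fin 4, a ≠ c → β a a c (0, 0, 0) = if σ a = 0 ∧ σ c = 1 then P else 0)
    (hCz : ∀ a b c : Fin 4, a ≠ b → a ≠ c → b ≠ c → β a b c (0, 0, 0) = 0)
    (hc₀ : 0 < c₀) (hP0 : 0 ≤ P) (hf : 0 < f) (hκ : 0 < κ)
    (hpair : 13 * P ^ 2 < f ^ 2 * κ ^ 4)
    (hdrain : 10 * P * κ * (1 + ε₀) ^ ((5 : ℝ) / 2) ≤ c₀ * ((1 + ε₀) ^ ((101 : ℝ) / 200)) ^ 2)
    (hP1 : P * (1 + ε₀) ^ ((5 : ℝ) / 2) ≤ c₀ * ((1 + ε₀) ^ ((101 : ℝ) / 200)) ^ 2) :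
    Literature.Analysis.FluidPDE.TaoCascade.InTableClass R β →
      (∀ (Y : Fin 4 → ℤ → ℝ → ℝ) (τ : ℝ), (∀ (j : Fin 4) (k : ℤ), 1 ≤ k → 0 ≤ Y j k τ) → ∀ δ : ℝ, 0 < δ →
        ∀ (i : Fin 4) (n : ℤ), 1 ≤ n → Y i n τ = 0 → 0 ≤ Literature.Analysis.FluidPDE.TaoCascade.quadTerm δ β Y i n τ) →
      (∀ a b i : Fin 4, a ≠ b → β a b i (0, 0, 1) = 0) →
      ∃ (lev : Fin 4 → ℕ) (L : ℕ), (∀ a, lev a ≤ L) ∧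
        (∀ a, lev a ≠ 0 → (∃ e, β a a e (0, 0, 1) ≠ 0) →
          (∀ j, β j j a (0, 0, 1) ≠ 0 → lev j < lev a ∧ (lev j = 0 ∨ ∃ e', β j j e' (0, 0, 1) ≠ 0)) ∧
          (∀ i₁ i₂, i₁ ≠ a → i₂ ≠ a → β i₁ i₂ a (0, 0, 0) ≠ 0 →
            (lev i₁ < lev a ∧ (lev i₁ = 0 ∨ ∃ e', β i₁ i₁ e' (0, 0, 1) ≠ 0)) ∧
            (lev i₂ < lev a ∧ (lev i₂ = 0 ∨ ∃ e', β i₂ i₂ e' (0, 0, 1) ≠ 0))) ∧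
          (∃ e, β a a e (0, 0, 1) ≠ 0 ∧
            (∀ j, β e e j (0, 0, 1) ≠ 0 → lev j < lev a ∧ (lev j = 0 ∨ ∃ e', β j j e' (0, 0, 1) ≠ 0)) ∧
            (∀ j, j ≠ e → β e e j (0, 0, 0) ≠ 0 →
              lev j < lev a ∧ (lev j = 0 ∨ ∃ e', β j j e' (0, 0, 1) ≠ 0)))) ∧
        ∃ θ : ℝ, 1 / 2 < θ ∧ θ ≤ 1 ∧ ∃ D : ℝ, 0 ≤ D ∧
          ∀ ν : ℝ, 0 < ν → ∀ (X₀ : Fin 4 → ℝ) (s : ℝ), 0 < s → ∀ X : Fin 4 → ℤ → ℝ → ℝ,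
          (∀ (i : Fin 4) (k : ℤ), X i k 0 = if k = 0 then X₀ i else 0) →
          (∀ (i : Fin 4) (k : ℤ), k < 0 → ∀ t : ℝ, X i k t = 0) →
          (∃ M : ℝ, ∀ (t : ℝ) (i : Fin 4) (k : ℤ), (1 + (1 + ε₀) ^ ((10 : ℝ) * k)) * |X i k t| ≤ M) →
          (∀ (i : Fin 4) (k : ℤ), Continuous (X i k)) →
          (∀ (i : Fin 4) (k : ℤ), ∀ t ∈ Set.Icc (0 : ℝ) s, HasDerivWithinAt (X i k)
            (Literature.Analysis.FluidPDE.TaoCascade.quadTerm ε₀ β X i k t - ν * (1 + ε₀) ^ ((2 : ℝ) * k) * X i k t)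
            (Set.Icc (0 : ℝ) s) t) →
          (∀ t ∈ Set.Icc (0 : ℝ) s, ∀ (i : Fin 4) (k : ℤ), 1 ≤ k → 0 ≤ X i k t) →
          ∀ t ∈ Set.Icc (0 : ℝ) s, ∀ i, lev i = 0 → ∀ k : ℕ,
            (1 + ε₀) ^ (2 * θ * (k : ℝ)) * ((1 / 2 : ℝ) * X i (k : ℤ) t ^ 2) ≤
              D * (∑ j : Fin 4, (1 / 2 : ℝ) * X₀ j ^ 2) :=
  kpPrimaryGraded_of_fwdCeilingKPAt (by linarith)
    (kpRelabel_sideClassTen_fwdCeilingKP σ R hε hε1 hw hP hCz hc₀ hP0 hf hκ hpair hdrain hP1)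

end Summit.NavierStokesRegularity.NavierStokesRegularity.Theorems

end
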